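import Mathlib.Analysis.Calculus.BumpFunction.Normed
import Mathlib.Analysis.Calculus.BumpFunction.InnerProduct
import Mathlib.Analysis.Calculus.LineDeriv.IntegrationByParts
import Mathlib.MeasureTheory.Measure.Haar.NormedSpace
import Literature.Analysis.Complex.CauchyTransform
import Literature.Analysis.Complex.HolomorphicParametricIntegral
import HarnessLib

/-!
# The smoothing step in Mergelyan's theorem (Rudin, *Real and Complex Analysis*, 20.5 (3)–(5))

For a continuous compactly supported `f : ℂ → ℂ` and `δ > 0`, Rudin's proof of Mergelyan's
theorem (Thm. 20.5) mollifies `f` by a `C¹_c` bump `A` supported in `|z| < δ` with `∫ A = 1` and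
`∫ |∂̄A| < 2/δ` ((6)–(10)), getting `Φ = A ⋆ f ∈ C¹_c` with

* (3) `|f − Φ| ≤ ω(δ)` (`ω` = modulus of continuity of `f`),
* (4) `|∂̄Φ| < 2ω(δ)/δ` ((13): `∂̄Φ = ∫ [f(z − ζ) − f(z)] ∂̄A(ζ)`),
* (14) `Φ = f`, hence `∂̄Φ = 0`, at points whose `δ`-neighbourhood lies where `f` is holomorphic
  (mean value property for the radial kernel), and
* (5) the Cauchy–Pompeiu representation of `Φ` by `∂̄Φ` (Lemma 20.3).

We prove (3), (4), (5) and the consequence `∂̄Φ = 0` of (14) with Mathlib's normed bump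
functions in place of Rudin's explicit radial kernel `(3/πδ²)(1 − |z|²/δ²)²`: the constant `2`
of (4) becomes an absolute constant `C₀ = ∫ ‖D A₁‖` (the `L¹` norm of the gradient of the
unit-scale bump, transported to scale `δ` by `z ↦ z/δ`), and instead of the mean value property
we show directly that `Φ` is complex-differentiable at such points (holomorphic dependence of the
integral `∫ A(t) f(z − t) dt` on `z`, `Literature.Analysis.Complex.hasFDerivAt_integral_of_dominated_of_differentiableOn`),
which is all the proof of Thm. 20.5 uses.

* `Literature.Analysis.Complex.exists_scaled_bump` — bumps at scale `δ` with
  `∫ ‖D A_δ‖ ≤ C₀/δ`;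
* `Literature.Analysis.Complex.mollify_props` — properties (3), (4), holomorphy, `C¹_c` of
  `A ⋆ f` for a given bump `A`;
* `Literature.Analysis.Complex.exists_mergelyan_smoothing` — the package used by the proof of
  Mergelyan's theorem: `∃ C₀ ≥ 0, ∀ f δ ω, ∃ Φ ∈ C¹_c`, `|Φ − f| ≤ ω`, `‖DΦ(z)v‖ ≤ (C₀/δ) ω ‖v‖`,
  `|∂̄Φ| ≤ C₀ ω/δ`, `∂̄Φ(z) = 0` whenever `f` is holomorphic on a disc `|w − z| < R`, `R > δ`, and
  Cauchy–Pompeiu `Φ(z) = ∫ (πt)⁻¹ ∂̄Φ(z − t) dA(t)`.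

## References

* W. Rudin, *Real and Complex Analysis*, 3rd ed., McGraw-Hill (1987), proof of Thm. 20.5,
  (3)–(15) (held copy, PDF pp. 319–320); Lemma 20.3. [Rudin1987]
* D. Gaier, *Lectures on Complex Approximation*, Birkhäuser (1987), Ch. III §2 C, 1st step,
  (2.7)–(2.10) (PDF pp. 115–117). [Gaier1987]
-/

noncomputable section

open Set Filter Metric Topology MeasureTheory Function Complex ContinuousLinearMap
open scoped Convolution Real

namespace Literature.Analysis.Complex

/-! ### Bumps at scale `δ` -/

/-- **Scaling a bump.** If `ψ ∈ C¹(ℂ, ℝ)` is nonnegative with `∫ ψ = 1` and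
`support ψ ⊆ ball 0 1`, then `φ(t) = δ⁻² ψ(t/δ)` is `C¹_c`, nonnegative, `∫ φ = 1`,
`support φ ⊆ ball 0 δ` and `∫ ‖Dφ‖ ≤ δ⁻¹ ∫ ‖Dψ‖`. [folklore] -/
theorem scaled_bump_props {ψ : ℂ → ℝ} (hψ : ContDiff ℝ 1 ψ)
    (hψ0 : ∀ x, 0 ≤ ψ x) (hψ1 : ∫ x, ψ x = 1) (hψs : support ψ ⊆ ball 0 1) {δ : ℝ}
    (hδ : 0 < δ) :
    ContDiff ℝ 1 (fun t : ℂ ↦ (δ⁻¹) ^ 2 * ψ (δ⁻¹ • t)) ∧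
    HasCompactSupport (fun t : ℂ ↦ (δ⁻¹) ^ 2 * ψ (δ⁻¹ • t)) ∧
    (∀ t, 0 ≤ (δ⁻¹) ^ 2 * ψ (δ⁻¹ • t)) ∧
    ∫ t : ℂ, (δ⁻¹) ^ 2 * ψ (δ⁻¹ • t) = 1 ∧
    support (fun t : ℂ ↦ (δ⁻¹) ^ 2 * ψ (δ⁻¹ • t)) ⊆ ball 0 δ ∧
    ∫ t : ℂ, ‖fderiv ℝ (fun t : ℂ ↦ (δ⁻¹) ^ 2 * ψ (δ⁻¹ • t)) t‖ ≤
      δ⁻¹ * ∫ u : ℂ, ‖fderiv ℝ ψ u‖ := by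
  have hs0 : 0 < δ⁻¹ := inv_pos.2 hδ
  set φ : ℂ → ℝ := fun t ↦ (δ⁻¹) ^ 2 * ψ (δ⁻¹ • t) with hφdef
  have hφcd : ContDiff ℝ 1 φ := contDiff_const.mul (hψ.comp (contDiff_const_smul δ⁻¹))
  have hsupp : support φ ⊆ ball 0 δ := by
    intro t ht
    rw [mem_support] at ht
    have h1 : ψ (δ⁻¹ • t) ≠ 0 := fun h ↦ ht (by simp only [hφdef, h, mul_zero])
    have h2 : δ⁻¹ • t ∈ ball (0 : ℂ) 1 := hψs (mem_support.2 h1)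
    rw [mem_ball_zero_iff, norm_smul, Real.norm_of_nonneg hs0.le] at h2
    rw [mem_ball_zero_iff]
    have : δ⁻¹ * ‖t‖ < δ⁻¹ * δ := by rw [inv_mul_cancel₀ hδ.ne']; exact h2
    exact lt_of_mul_lt_mul_left this hs0.le
  have hφc : HasCompactSupport φ := by
    refine HasCompactSupport.intro (isCompact_closedBall (0 : ℂ) δ) fun t ht ↦ ?_
    by_contra h
    exact ht (ball_subset_closedBall (hsupp (mem_support.2 h)))
  have hφ0 : ∀ t, 0 ≤ φ t := fun t ↦ mul_nonneg (sq_nonneg _) (hψ0 _)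
  have hfin : Module.finrank ℝ ℂ = 2 := Complex.finrank_real_complex
  have hφ1 : ∫ t, φ t = 1 := by
    simp only [hφdef]
    rw [integral_const_mul, Measure.integral_comp_smul volume ψ δ⁻¹, hfin, hψ1, smul_eq_mul,
      mul_one, abs_of_nonneg (by positivity)]
    exact mul_inv_cancel₀ (by positivity)
  -- derivative bound
  have hψd : ∀ x, DifferentiableAt ℝ ψ x := fun x ↦ (hψ.differentiable one_ne_zero) x
  have hptw : ∀ t, ‖fderiv ℝ φ t‖ ≤ (δ⁻¹) ^ 3 * ‖fderiv ℝ ψ (δ⁻¹ • t)‖ := by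
    intro t
    have h2 : HasFDerivAt (fun t : ℂ ↦ δ⁻¹ • t) (δ⁻¹ • ContinuousLinearMap.id ℝ ℂ) t :=
      (hasFDerivAt_id t).const_smul δ⁻¹
    have hcomp : HasFDerivAt (fun t : ℂ ↦ ψ (δ⁻¹ • t))
        ((fderiv ℝ ψ (δ⁻¹ • t)).comp (δ⁻¹ • ContinuousLinearMap.id ℝ ℂ)) t :=
      (hψd (δ⁻¹ • t)).hasFDerivAt.comp t h2
    have hφ' : HasFDerivAt φ (((δ⁻¹) ^ 2) • ((fderiv ℝ ψ (δ⁻¹ • t)).comp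
        (δ⁻¹ • ContinuousLinearMap.id ℝ ℂ))) t := hcomp.const_mul ((δ⁻¹) ^ 2)
    rw [hφ'.fderiv, norm_smul, Real.norm_of_nonneg (sq_nonneg _)]
    calc (δ⁻¹) ^ 2 * ‖(fderiv ℝ ψ (δ⁻¹ • t)).comp (δ⁻¹ • ContinuousLinearMap.id ℝ ℂ)‖
        ≤ (δ⁻¹) ^ 2 * (‖fderiv ℝ ψ (δ⁻¹ • t)‖ * ‖δ⁻¹ • ContinuousLinearMap.id ℝ ℂ‖) := by
          gcongr; exact opNorm_comp_le _ _
      _ ≤ (δ⁻¹) ^ 2 * (‖fderiv ℝ ψ (δ⁻¹ • t)‖ * δ⁻¹) := by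
          gcongr
          rw [norm_smul, Real.norm_of_nonneg hs0.le]
          calc δ⁻¹ * ‖ContinuousLinearMap.id ℝ ℂ‖ ≤ δ⁻¹ * 1 := by gcongr; exact norm_id_le
            _ = δ⁻¹ := mul_one _
      _ = (δ⁻¹) ^ 3 * ‖fderiv ℝ ψ (δ⁻¹ • t)‖ := by ring
  have hint1 : Integrable (fun t ↦ ‖fderiv ℝ φ t‖) :=
    ((hφcd.continuous_fderiv one_ne_zero).norm).integrable_of_hasCompactSupport
      (hφc.fderiv ℝ).norm
  have hint2 : Integrable (fun t : ℂ ↦ (δ⁻¹) ^ 3 * ‖fderiv ℝ ψ (δ⁻¹ • t)‖) := by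
    have hc : Continuous fun t : ℂ ↦ ‖fderiv ℝ ψ (δ⁻¹ • t)‖ :=
      ((hψ.continuous_fderiv one_ne_zero).comp (continuous_const_smul δ⁻¹)).norm
    refine (hc.integrable_of_hasCompactSupport ?_).const_mul _
    refine HasCompactSupport.intro (isCompact_closedBall (0 : ℂ) δ) fun t ht ↦ ?_
    have hst : δ⁻¹ • t ∉ tsupport (fderiv ℝ ψ) := by
      intro h
      have h1 := (tsupport_fderiv_subset ℝ) h
      have h2 : tsupport ψ ⊆ closedBall 0 1 := by
        rw [← closure_ball (0 : ℂ) one_ne_zero]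
        exact closure_mono hψs
      have h3 := mem_closedBall_zero_iff.1 (h2 h1)
      rw [norm_smul, Real.norm_of_nonneg hs0.le] at h3
      apply ht
      rw [mem_closedBall_zero_iff]
      have : δ⁻¹ * ‖t‖ ≤ δ⁻¹ * δ := by rw [inv_mul_cancel₀ hδ.ne']; exact h3
      exact le_of_mul_le_mul_left this hs0
    rw [image_eq_zero_of_notMem_tsupport hst, norm_zero]
  have hI : ∫ t, ‖fderiv ℝ φ t‖ ≤ δ⁻¹ * ∫ u, ‖fderiv ℝ ψ u‖ := by
    have h3 : (δ⁻¹) ^ 3 * ((δ⁻¹) ^ 2)⁻¹ = δ⁻¹ := by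
      rw [pow_succ, mul_comm ((δ⁻¹) ^ 2) δ⁻¹, mul_assoc, mul_inv_cancel₀ (by positivity),
        mul_one]
    calc ∫ t, ‖fderiv ℝ φ t‖ ≤ ∫ t : ℂ, (δ⁻¹) ^ 3 * ‖fderiv ℝ ψ (δ⁻¹ • t)‖ :=
          integral_mono hint1 hint2 hptw
      _ = (δ⁻¹) ^ 3 * ∫ t : ℂ, ‖fderiv ℝ ψ (δ⁻¹ • t)‖ := integral_const_mul _ _
      _ = δ⁻¹ * ∫ u, ‖fderiv ℝ ψ u‖ := by
          rw [Measure.integral_comp_smul volume (fun u ↦ ‖fderiv ℝ ψ u‖) δ⁻¹, hfin, smul_eq_mul,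
            abs_of_nonneg (by positivity), ← mul_assoc, h3]
  exact ⟨hφcd, hφc, hφ0, hφ1, hsupp, hI⟩

/-- **Bumps at every scale with `L¹`-controlled gradient**: there is an absolute constant
`C₀ ≥ 0` such that for every `δ > 0` some `φ ∈ C¹_c(ℂ, ℝ)` is nonnegative with `∫ φ = 1`,
`support φ ⊆ ball 0 δ` and `∫ ‖Dφ‖ ≤ C₀/δ` (Rudin's (6)–(10) with `24/15 < 2` replaced by `C₀`).
[cite: Rudin1987, Thm. 20.5 ((6)–(10))] -/
theorem exists_scaled_bump : ∃ C₀ : ℝ, 0 ≤ C₀ ∧ ∀ δ : ℝ, 0 < δ →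
    ∃ φ : ℂ → ℝ, ContDiff ℝ 1 φ ∧ HasCompactSupport φ ∧ (∀ t, 0 ≤ φ t) ∧ ∫ t, φ t = 1 ∧
      support φ ⊆ ball 0 δ ∧ ∫ t, ‖fderiv ℝ φ t‖ ≤ C₀ / δ := by
  set ψ₀ : ContDiffBump (0 : ℂ) := ⟨1 / 2, 1, by norm_num, by norm_num⟩ with hψ₀
  set ψ : ℂ → ℝ := ψ₀.normed volume with hψ
  refine ⟨∫ u, ‖fderiv ℝ ψ u‖, integral_nonneg fun u ↦ norm_nonneg _, fun δ hδ ↦ ?_⟩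
  have hψs : support ψ ⊆ ball 0 1 := by rw [hψ, ψ₀.support_normed_eq]
  obtain ⟨h1, h2, h3, h4, h5, h6⟩ := scaled_bump_props ψ₀.contDiff_normed
    ψ₀.nonneg_normed ψ₀.integral_normed hψs hδ
  exact ⟨_, h1, h2, h3, h4, h5, by rwa [div_eq_inv_mul]⟩

/-! ### Mollification -/

/-- The integral of a directional derivative of a `C¹_c` function vanishes. [folklore] -/
theorem integral_fderiv_apply_eq_zero {φ : ℂ → ℝ} (hφ : ContDiff ℝ 1 φ)
    (hφc : HasCompactSupport φ) (v : ℂ) : ∫ t, fderiv ℝ φ t v = 0 := by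
  have hφd : ∀ x, DifferentiableAt ℝ φ x := fun x ↦ (hφ.differentiable one_ne_zero) x
  have hcont : Continuous fun t ↦ fderiv ℝ φ t v :=
    (hφ.continuous_fderiv one_ne_zero).clm_apply continuous_const
  have hcs : HasCompactSupport fun t ↦ fderiv ℝ φ t v := by
    refine (hφc.fderiv ℝ).mono ?_
    intro t ht
    rw [mem_support] at ht ⊢
    exact fun h ↦ ht (by rw [h]; rfl)
  have h1 : Integrable (fun x : ℂ ↦ fderiv ℝ (fun (_ : ℂ) ↦ (1 : ℝ)) x v * φ x) volume := by
    simp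
  have h2 : Integrable (fun x : ℂ ↦ (fun (_ : ℂ) ↦ (1 : ℝ)) x * fderiv ℝ φ x v) volume := by
    simpa using hcont.integrable_of_hasCompactSupport hcs
  have h3 : Integrable (fun x : ℂ ↦ (fun (_ : ℂ) ↦ (1 : ℝ)) x * φ x) volume := by
    simpa using hφ.continuous.integrable_of_hasCompactSupport hφc
  have key := integral_mul_fderiv_eq_neg_fderiv_mul_of_integrable h1 h2 h3
    (fun x _ ↦ differentiableAt_const _) (fun x _ ↦ hφd x)
  simpa using key

/-- **Properties of the mollification `Φ = φ ⋆ f`** (Rudin, proof of Thm. 20.5, (3), (4), (13),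
(14)). Let `φ ∈ C¹_c(ℂ, ℝ)` be nonnegative with `∫ φ = 1`, `support φ ⊆ ball 0 δ`,
`∫ ‖Dφ‖ ≤ D`, let `f : ℂ → ℂ` be continuous with compact support, and suppose
`‖f(z − t) − f(z)‖ ≤ ω` whenever `‖t‖ ≤ δ`. Then `Φ = φ ⋆ f` is `C¹` with compact support,
`‖Φ − f‖ ≤ ω`, `‖DΦ(z) v‖ ≤ D ω ‖v‖`, and `Φ` is complex-differentiable at every `z` such that `f`
is holomorphic on a disc `ball z R` with `R > δ`. [cite: Rudin1987, Thm. 20.5 ((3)–(4), (11)–(15))] -/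
theorem mollify_props {φ : ℂ → ℝ} (hφ : ContDiff ℝ 1 φ) (hφc : HasCompactSupport φ)
    (hφ0 : ∀ t, 0 ≤ φ t) (hφ1 : ∫ t, φ t = 1) {δ D : ℝ} (hδ : 0 < δ)
    (hφs : support φ ⊆ ball 0 δ) (hφD : ∫ t, ‖fderiv ℝ φ t‖ ≤ D)
    {f : ℂ → ℂ} (hf : Continuous f) (hfc : HasCompactSupport f) {ω : ℝ}
    (hω : ∀ z t : ℂ, ‖t‖ ≤ δ → ‖f (z - t) - f z‖ ≤ ω) :
    ContDiff ℝ 1 (φ ⋆[lsmul ℝ ℝ, volume] f) ∧ HasCompactSupport (φ ⋆[lsmul ℝ ℝ, volume] f) ∧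
    (∀ z, ‖(φ ⋆[lsmul ℝ ℝ, volume] f) z - f z‖ ≤ ω) ∧
    (∀ z v, ‖fderiv ℝ (φ ⋆[lsmul ℝ ℝ, volume] f) z v‖ ≤ D * ω * ‖v‖) ∧
    (∀ z R, δ < R → DifferentiableOn ℂ f (ball z R) →
      DifferentiableAt ℂ (φ ⋆[lsmul ℝ ℝ, volume] f) z) := by
  set Φ := φ ⋆[lsmul ℝ ℝ, volume] f with hΦdef
  have hω0 : 0 ≤ ω := by
    have := hω 0 0 (by rw [norm_zero]; exact hδ.le)
    rw [sub_zero, sub_self, norm_zero] at this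
    exact this
  have hfli : LocallyIntegrable f volume := hf.locallyIntegrable
  have hφd : ∀ x, DifferentiableAt ℝ φ x := fun x ↦ (hφ.differentiable one_ne_zero) x
  -- (3)
  have h3 : ∀ z, ‖Φ z - f z‖ ≤ ω := by
    intro z
    rw [← dist_eq_norm]
    refine dist_convolution_le hω0 hφs hφ0 hφ1 hf.aestronglyMeasurable fun x hx ↦ ?_
    rw [dist_eq_norm]
    have := hω z (z - x) (by rw [← dist_eq_norm, dist_comm]; exact (mem_ball.1 hx).le)
    rwa [sub_sub_cancel] at this
  -- C¹_c
  have hC1 : ContDiff ℝ 1 Φ := hφc.contDiff_convolution_left _ hφ hfli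
  have hcs : HasCompactSupport Φ := hφc.convolution _ hfc
  -- (4): the derivative
  have h4 : ∀ z v, ‖fderiv ℝ Φ z v‖ ≤ D * ω * ‖v‖ := by
    intro z v
    set L' : ℂ →L[ℝ] ℝ →L[ℝ] ℂ := (lsmul ℝ ℝ : ℝ →L[ℝ] ℂ →L[ℝ] ℂ).flip with hL'
    have hflip : Φ = f ⋆[L', volume] φ := by rw [hΦdef, hL', convolution_flip]
    have hD : HasFDerivAt (f ⋆[L', volume] φ)
        ((f ⋆[L'.precompR ℂ, volume] fderiv ℝ φ) z) z :=
      hφc.hasFDerivAt_convolution_right L' hfli hφ z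
    have happ : (f ⋆[L'.precompR ℂ, volume] fderiv ℝ φ) z v =
        (f ⋆[L', volume] fun a ↦ fderiv ℝ φ a v) z :=
      convolution_precompR_apply L' hfli (hφc.fderiv ℝ) (hφ.continuous_fderiv one_ne_zero) z v
    rw [hflip, hD.fderiv, happ, convolution_def]
    simp only [hL', flip_apply, lsmul_apply]
    -- `∫ (Dφ (z - t) v) • f t = ∫ (Dφ (z - t) v) • (f t - f z)`
    have hzero : ∫ t, fderiv ℝ φ (z - t) v = 0 := by
      rw [integral_sub_left_eq_self (fun u ↦ fderiv ℝ φ u v) volume z]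
      exact integral_fderiv_apply_eq_zero hφ hφc v
    have hcont1 : Continuous fun t ↦ fderiv ℝ φ (z - t) v :=
      ((hφ.continuous_fderiv one_ne_zero).comp (continuous_const.sub continuous_id)).clm_apply
        continuous_const
    have hbd : ∀ t, ‖fderiv ℝ φ (z - t) v • (f t - f z)‖ ≤ ‖fderiv ℝ φ (z - t)‖ * (ω * ‖v‖) := by
      intro t
      by_cases ht : ‖z - t‖ ≤ δ
      · rw [norm_smul]
        have h1 : ‖fderiv ℝ φ (z - t) v‖ ≤ ‖fderiv ℝ φ (z - t)‖ * ‖v‖ := le_opNorm _ _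
        have h2 : ‖f t - f z‖ ≤ ω := by
          have := hω z (z - t) ht
          rwa [sub_sub_cancel] at this
        calc ‖fderiv ℝ φ (z - t) v‖ * ‖f t - f z‖ ≤ ‖fderiv ℝ φ (z - t)‖ * ‖v‖ * ω := by
              gcongr
          _ = ‖fderiv ℝ φ (z - t)‖ * (ω * ‖v‖) := by ring
      · have hnot : z - t ∉ tsupport φ := by
          intro h
          have h1 : tsupport φ ⊆ closedBall 0 δ := by
            rw [← closure_ball (0 : ℂ) hδ.ne']
            exact closure_mono hφs
          exact ht (mem_closedBall_zero_iff.1 (h1 h))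
        rw [fderiv_of_notMem_tsupport ℝ hnot]
        simp
    -- integrability
    have hcsD : HasCompactSupport fun t ↦ fderiv ℝ φ (z - t) := by
      refine HasCompactSupport.intro (isCompact_closedBall z δ) fun t ht ↦ ?_
      refine fderiv_of_notMem_tsupport ℝ fun h ↦ ht ?_
      have h1 : tsupport φ ⊆ closedBall 0 δ := by
        rw [← closure_ball (0 : ℂ) hδ.ne']
        exact closure_mono hφs
      have := mem_closedBall_zero_iff.1 (h1 h)
      rw [mem_closedBall, dist_comm, dist_eq_norm]
      exact this
    have hcontD : Continuous fun t ↦ fderiv ℝ φ (z - t) :=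
      (hφ.continuous_fderiv one_ne_zero).comp (continuous_const.sub continuous_id)
    have hintg : Integrable fun t ↦ ‖fderiv ℝ φ (z - t)‖ * (ω * ‖v‖) :=
      (hcontD.norm.integrable_of_hasCompactSupport hcsD.norm).mul_const _
    have hcsDv : HasCompactSupport fun t ↦ fderiv ℝ φ (z - t) v :=
      hcsD.mono fun t ht ↦ by
        rw [mem_support] at ht ⊢
        exact fun h ↦ ht (by rw [h]; rfl)
    have hint1 : Integrable fun t ↦ fderiv ℝ φ (z - t) v • f t :=
      (hcont1.smul hf).integrable_of_hasCompactSupport hcsDv.smul_right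
    have hint2 : Integrable fun t ↦ fderiv ℝ φ (z - t) v • f z :=
      (hcont1.integrable_of_hasCompactSupport hcsDv).smul_const _
    have heq : ∫ t, fderiv ℝ φ (z - t) v • f t = ∫ t, fderiv ℝ φ (z - t) v • (f t - f z) := by
      simp_rw [smul_sub]
      rw [integral_sub hint1 hint2, integral_smul_const, hzero, zero_smul, sub_zero]
    rw [heq]
    calc ‖∫ t, fderiv ℝ φ (z - t) v • (f t - f z)‖
        ≤ ∫ t, ‖fderiv ℝ φ (z - t)‖ * (ω * ‖v‖) :=
          norm_integral_le_of_norm_le hintg (Eventually.of_forall hbd)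
      _ = (∫ t, ‖fderiv ℝ φ (z - t)‖) * (ω * ‖v‖) := integral_mul_const _ _
      _ = (∫ u, ‖fderiv ℝ φ u‖) * (ω * ‖v‖) := by
          rw [integral_sub_left_eq_self (fun u ↦ ‖fderiv ℝ φ u‖) volume z]
      _ ≤ D * (ω * ‖v‖) := by gcongr
      _ = D * ω * ‖v‖ := by ring
  -- holomorphy where `f` is holomorphic on a larger disc
  have h5 : ∀ z R, δ < R → DifferentiableOn ℂ f (ball z R) → DifferentiableAt ℂ Φ z := by
    intro z R hR hfR
    have hΦeq : Φ = fun w ↦ ∫ t, φ t • f (w - t) := by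
      funext w
      rw [hΦdef, convolution_lsmul]
    obtain ⟨M, hM⟩ := hf.bounded_above_of_compact_support hfc
    have hR₀ : 0 < R - δ := by linarith
    have hmeas : ∀ p ∈ ball z (R - δ), AEStronglyMeasurable (fun t ↦ φ t • f (p - t)) volume :=
      fun p _ ↦ (hφ.continuous.smul (hf.comp (continuous_const.sub continuous_id))).aestronglyMeasurable
    have hdiff : ∀ᵐ t ∂(volume : Measure ℂ),
        DifferentiableOn ℂ (fun p ↦ φ t • f (p - t)) (ball z (R - δ)) := by
      refine Eventually.of_forall fun t ↦ ?_
      by_cases ht : φ t = 0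
      · simp only [ht, zero_smul]
        exact differentiableOn_const _
      · have htδ : ‖t‖ < δ := mem_ball_zero_iff.1 (hφs (mem_support.2 ht))
        have hmaps : MapsTo (fun p : ℂ ↦ p - t) (ball z (R - δ)) (ball z R) := by
          intro p hp
          rw [mem_ball, dist_eq_norm] at hp ⊢
          calc ‖p - t - z‖ = ‖(p - z) - t‖ := by ring_nf
            _ ≤ ‖p - z‖ + ‖t‖ := norm_sub_le _ _
            _ < (R - δ) + δ := add_lt_add hp htδ
            _ = R := by ring
        exact ((hfR.comp (differentiableOn_id.sub_const t) hmaps).const_smul (φ t))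
    have hbound : Integrable (fun t ↦ M * φ t) :=
      (hφ.continuous.integrable_of_hasCompactSupport hφc).const_mul M
    have hFb : ∀ᵐ t ∂(volume : Measure ℂ), ∀ p ∈ ball z (R - δ), ‖φ t • f (p - t)‖ ≤ M * φ t := by
      refine Eventually.of_forall fun t p _ ↦ ?_
      rw [norm_smul, Real.norm_of_nonneg (hφ0 t), mul_comm]
      gcongr
      · exact hφ0 t
      · exact hM _
    obtain ⟨L, -, hL⟩ := hasFDerivAt_integral_of_dominated_of_differentiableOn hR₀ hmeas hdiff
      hbound hFb
    rw [hΦeq]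
    exact hL.differentiableAt
  exact ⟨hC1, hcs, h3, h4, h5⟩

/-- `‖∂̄_1 Φ(z)‖ ≤ B` when `‖DΦ(z) v‖ ≤ B ‖v‖` for all `v`. [folklore] -/
theorem norm_dbarAlong_one_le {Φ : ℂ → ℂ} {z : ℂ} {B : ℝ}
    (h : ∀ v, ‖fderiv ℝ Φ z v‖ ≤ B * ‖v‖) : ‖dbarAlong 1 Φ z‖ ≤ B := by
  rw [dbarAlong_one]
  have h1 := h 1
  have hI := h I
  rw [norm_one, mul_one] at h1
  rw [norm_I, mul_one] at hI
  calc ‖(2 : ℂ)⁻¹ • (fderiv ℝ Φ z 1 + I • fderiv ℝ Φ z I)‖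
      = 2⁻¹ * ‖fderiv ℝ Φ z 1 + I • fderiv ℝ Φ z I‖ := by
        rw [norm_smul, norm_inv, Complex.norm_two]
    _ ≤ 2⁻¹ * (‖fderiv ℝ Φ z 1‖ + ‖I • fderiv ℝ Φ z I‖) := by gcongr; exact norm_add_le _ _
    _ = 2⁻¹ * (‖fderiv ℝ Φ z 1‖ + ‖fderiv ℝ Φ z I‖) := by rw [norm_smul, norm_I, one_mul]
    _ ≤ 2⁻¹ * (B + B) := by gcongr
    _ = B := by ring

/-- **The smoothing step of Mergelyan's theorem** (Rudin, proof of Thm. 20.5, (3)–(5)). There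
is an absolute constant `C₀ ≥ 0` with the following property. For `f : ℂ → ℂ` continuous with
compact support, `δ > 0` and `ω` with `‖f(z − t) − f(z)‖ ≤ ω` for `‖t‖ ≤ δ`, there is
`Φ ∈ C¹_c(ℂ)` with `‖Φ − f‖ ≤ ω` ((3)), `‖DΦ(z) v‖ ≤ (C₀/δ) ω ‖v‖` and so
`‖∂̄Φ‖ ≤ C₀ ω/δ` ((4)), `∂̄Φ(z) = 0` whenever `f` is holomorphic on some disc `ball z R`,
`R > δ` ((14)), and the Cauchy–Pompeiu representation `Φ(z) = ∫ (πt)⁻¹ ∂̄Φ(z − t) dA(t)`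
((5), Lemma 20.3). [cite: Rudin1987, Thm. 20.5 ((3)–(5))] -/
theorem exists_mergelyan_smoothing : ∃ C₀ : ℝ, 0 ≤ C₀ ∧
    ∀ (f : ℂ → ℂ), Continuous f → HasCompactSupport f → ∀ δ : ℝ, 0 < δ → ∀ ω : ℝ,
      (∀ z t : ℂ, ‖t‖ ≤ δ → ‖f (z - t) - f z‖ ≤ ω) →
      ∃ Φ : ℂ → ℂ, ContDiff ℝ 1 Φ ∧ HasCompactSupport Φ ∧ (∀ z, ‖Φ z - f z‖ ≤ ω) ∧
        (∀ z v, ‖fderiv ℝ Φ z v‖ ≤ C₀ / δ * ω * ‖v‖) ∧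
        (∀ z, ‖dbarAlong 1 Φ z‖ ≤ C₀ / δ * ω) ∧
        (∀ z R, δ < R → DifferentiableOn ℂ f (ball z R) → dbarAlong 1 Φ z = 0) ∧
        ∀ z, ∫ t : ℂ, (↑π * t)⁻¹ • dbarAlong 1 Φ (z - t) = Φ z := by
  obtain ⟨C₀, hC₀, hbump⟩ := exists_scaled_bump
  refine ⟨C₀, hC₀, fun f hf hfc δ hδ ω hω ↦ ?_⟩
  obtain ⟨φ, hφ, hφc, hφ0, hφ1, hφs, hφD⟩ := hbump δ hδ
  obtain ⟨hC1, hcs, h3, h4, h5⟩ := mollify_props hφ hφc hφ0 hφ1 hδ hφs hφD hf hfc hω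
  refine ⟨_, hC1, hcs, h3, h4, fun z ↦ norm_dbarAlong_one_le (h4 z), fun z R hR hfR ↦
    dbarAlong_eq_zero_of_differentiableAt (h5 z R hR hfR) 1, fun z ↦
    integral_inv_smul_dbarAlong_sub hC1 hcs z⟩

end Literature.Analysis.Complex
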